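/-
Copyright (c) 2026. All rights reserved.
Released under Apache 2.0 license as described in the file LICENSE.
Authors: abc-iut cell, wave-4 seat abc-iut-w4-d059 (proof-only; the (AI3) edge twin of row T54-0b: the
arithmetic decomposition group of a BRANCH — a commensurator inside the vertex group — is the stabiliser
of the pro-branch, i.e. of the adjacent pair of tree-vertex systems).
-/
import Literature.AnabelianGeometry.SemiGraphs.ArithVertGpStabilizer
import HarnessLib

/-!
# [SemiAnbd] §5 p. 65 / Thm 5.4 (i): `Π^temp_{𝔊,b}` (the commensurator of `Π^temp_{𝔾,b}` inside
# `Π^temp_{𝔊,v}`) is the stabiliser of the pro-branch of `b` (proof-only)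

Mochizuki, *Semi-graphs of anabelioids*, Publ. RIMS **42** (2006), §5 p. 65: "if `b` is a branch of an
edge `e` of `𝔾` that abuts to `v`, then we obtain a decomposition group `Π^temp_{𝔊,b} ⊆ Π^temp_{𝔊,v} ⊆
Π^temp_𝔊` …, which [since `𝔊` is totally estranged …] may be thought of as the commensurator in
`Π^temp_{𝔊,v}` of `Π^temp_{𝔾,b}`", with the proof of Thm 5.4 (i) p. 66 ("entirely similar to … Theorem
3.7 (iii)": the decomposition groups are stabilisers in the trees `T_j`). [cite: MochizukiSemiAnbd2006, §5, p. 65]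

PROOF-ONLY companion (abc-iut cell, sub-DAG `plan/L3/SUBDAG-SemiAnbd-Thm54.md`, the **(AI3) edge twin of
row T54-0b**, GO abc-iut-w4-d053 2026-08-26T01:19:46Z; producer abc-iut-w4-d053, coordinator
abc-iut-w4-d085).  No definition, no new named fact.  A pro-branch of the pro-tree at the pro-vertex `x`
is recorded by the ADJACENT PAIR `(x, y)` of compatible tree-vertex systems (its two end-points; the
abstract adjacency relation `Adj` is a parameter, required only to be invariant under the action), and
the geometric branch group by the full `Π^temp_𝔾`-stabiliser `{n | n fixes x and y}` of the pair.

* Generic core `mem_commensurator_map_inf_iff_fixes_pair` (any injective `ι : N → Gtp` with normal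
  image, trees `T j` with `Gtp`-actions and equivariant transitions): for `H ∈ VN` the full `N`-stabiliser
  of `x` and `K` the full `N`-stabiliser of the adjacent pair `(x, y)`,
  `g ∈ C_{Gtp}(ι H) ⊓ C_{Gtp}(ι K) ↔ g` fixes `x` AND `y`.  Inputs: the vertex dictionary of
  `mem_commensurator_map_iff_fixes` (`hstabN`, `hrigid`, `huniq`), and for pairs: (`hEstabN`) the full
  `N`-stabiliser of an adjacent pair lies in the family `EN` (§3 edge-like subgroups), (`hErigid`)
  commensurable members of `EN` inside one member of `VN` coincide (total estrangement: the commensurator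
  of `Π_b` inside `Π_v` is `Π_b`, p. 65 bracket), (`hEinj`) two adjacent pairs `(x, y)`, `(x, y')` with the
  same `N`-stabiliser are equal (total estrangement again: `Π_b ∩ h Π_{b'} h⁻¹` is small).
* Instance `mem_arithBrGp_iff_fixes_pair`: for the PRODUCED data of abc-iut-w4-d053 (`arithBrGp R ι b =
  arithVertGp R ι v ⊓ C(ι (R.Hb b))` for `b` abutting to `v`, `arithBrGp_of_abuts`), with `R.Hv v` the
  stabiliser of `x` and `R.Hb b` the stabiliser of the adjacent pair `(x, y)`:
  `g ∈ arithBrGp R ι b ↔ g` fixes `x` and `y` — row "`arithBrGp` = stabiliser of the pro-branch".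

The tree combinatorics turning "fixes the adjacent pair `(x, y)`" into "fixes the eventual compatible
edge system joining them, with its branches" (the literal field texts `edge`/`edgeFix` of `ArithLevelData`)
is kept for a sequel.  Nothing here takes a side on [IUTchIII] Cor. 3.12; typed ≠ proved elsewhere.
-/

namespace Literature.AnabelianGeometry.SemiGraphs

open CategoryTheory
open scoped Pointwise

universe v u u' w

section Generic

variable {N : Type u} [Group N] {Gtp : Type u'} [Group Gtp] (ι : N →* Gtp)
variable {J : Type v} [Preorder J] (T : J → SemiGraph.{w}) (ρ : ∀ j, Gtp →* Aut (T j))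
  (f : ∀ ⦃i j : J⦄, i ≤ j → (T j ⟶ T i))

/-! ### The conjugate of the image of a pair-stabiliser -/

omit [Preorder J] in
/-- **The conjugate of the image of the `N`-stabiliser of a pair `(x, y)` is the image of the
`N`-stabiliser of the translated pair `(g·x, g·y)`** (for `ι(N)` normal in `Gtp`).
[cite: MochizukiSemiAnbd2006, §5, p. 65] -/
theorem conj_map_pairStabilizer_eq (hnorm : (ι.range).Normal) {x y : ∀ j, (T j).Vertex} (g : Gtp)
    {K K' : Subgroup N}
    (hK : ∀ n : N, n ∈ K ↔ (∀ j, (ρ j (ι n)).hom.vertexMap (x j) = x j) ∧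
      ∀ j, (ρ j (ι n)).hom.vertexMap (y j) = y j)
    (hK' : ∀ n : N, n ∈ K' ↔
      (∀ j, (ρ j (ι n)).hom.vertexMap ((ρ j g).hom.vertexMap (x j)) = (ρ j g).hom.vertexMap (x j)) ∧
      ∀ j, (ρ j (ι n)).hom.vertexMap ((ρ j g).hom.vertexMap (y j)) = (ρ j g).hom.vertexMap (y j)) :
    ConjAct.toConjAct g • K.map ι = K'.map ι := by
  ext z
  rw [Subgroup.mem_pointwise_smul_iff_inv_smul_mem, ← map_inv, ConjAct.smul_def,
    ConjAct.ofConjAct_toConjAct, inv_inv]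
  constructor
  · rintro ⟨n, hn, hnz⟩
    have hz : z = g * ι n * g⁻¹ := by
      rw [hnz]; group
    obtain ⟨m, hm⟩ : z ∈ ι.range := by
      rw [hz]; exact hnorm.conj_mem _ ⟨n, rfl⟩ g
    obtain ⟨hnx, hny⟩ := (hK n).mp hn
    refine ⟨m, (hK' m).mpr ⟨fun j => ?_, fun j => ?_⟩, hm⟩
    · rw [hm, hz, act_mul_vertexMap, act_mul_vertexMap, act_inv_act_vertexMap, hnx j]
    · rw [hm, hz, act_mul_vertexMap, act_mul_vertexMap, act_inv_act_vertexMap, hny j]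
  · rintro ⟨m, hm, rfl⟩
    obtain ⟨n, hn⟩ : g⁻¹ * ι m * g ∈ ι.range := by
      have := hnorm.conj_mem _ ⟨m, rfl⟩ g⁻¹
      rwa [inv_inv] at this
    obtain ⟨hmx, hmy⟩ := (hK' m).mp hm
    refine ⟨n, (hK n).mpr ⟨fun j => ?_, fun j => ?_⟩, hn.symm ▸ by group⟩
    · have key := congrArg ((ρ j g⁻¹).hom.vertexMap) (hmx j)
      rw [act_inv_act_vertexMap, ← act_mul_vertexMap, ← act_mul_vertexMap] at key
      rw [hn]
      exact key
    · have key := congrArg ((ρ j g⁻¹).hom.vertexMap) (hmy j)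
      rw [act_inv_act_vertexMap, ← act_mul_vertexMap, ← act_mul_vertexMap] at key
      rw [hn]
      exact key

/-! ### The commensurator of the image of a geometric branch group, inside the vertex group -/

/-- **[SemiAnbd] §5 p. 65, «`Π^temp_{𝔊,b}` = the commensurator in `Π^temp_{𝔊,v}` of `Π^temp_{𝔾,b}`» —
generic core of the (AI3) edge twin of row T54-0b.**  With the vertex dictionary of
`mem_commensurator_map_iff_fixes` (`VN`, `hstabN`, `hrigid`, `huniq`) and, for ADJACENT PAIRS of compatible
systems (an action-invariant relation `Adj`): (`hEstabN`) the full `N`-stabiliser of an adjacent pair is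
a member of `EN`; (`hErigid`) commensurable members of `EN` inside one member of `VN` coincide;
(`hEinj`) adjacent pairs `(x, y)`, `(x, y')` with the same `N`-stabiliser coincide.  Then for `H ∈ VN` the
stabiliser of `x` and `K` the stabiliser of the adjacent pair `(x, y)`:
`g ∈ C_{Gtp}(ι H) ⊓ C_{Gtp}(ι K) ↔ g` fixes `x` and `y`. [cite: MochizukiSemiAnbd2006, §5, p. 65] -/
theorem mem_commensurator_map_inf_iff_fixes_pair (hι : Function.Injective ι) (hnorm : (ι.range).Normal)
    (hequiv : ∀ ⦃i j : J⦄ (h : i ≤ j) (g : Gtp) (z : (T j).Vertex),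
      (f h).vertexMap ((ρ j g).hom.vertexMap z) = (ρ i g).hom.vertexMap ((f h).vertexMap z))
    (VN EN : Set (Subgroup N))
    (hstabN : ∀ x : ∀ j, (T j).Vertex, (∀ ⦃i j : J⦄ (h : i ≤ j), (f h).vertexMap (x j) = x i) →
      ∃ H ∈ VN, ∀ n : N, n ∈ H ↔ ∀ j, (ρ j (ι n)).hom.vertexMap (x j) = x j)
    (hrigid : ∀ H ∈ VN, ∀ H' ∈ VN, Subgroup.Commensurable H H' → H = H')
    (huniq : ∀ H ∈ VN, ∀ x x' : ∀ j, (T j).Vertex,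
      (∀ ⦃i j : J⦄ (h : i ≤ j), (f h).vertexMap (x j) = x i) →
      (∀ ⦃i j : J⦄ (h : i ≤ j), (f h).vertexMap (x' j) = x' i) →
      (∀ n ∈ H, ∀ j, (ρ j (ι n)).hom.vertexMap (x j) = x j) →
      (∀ n ∈ H, ∀ j, (ρ j (ι n)).hom.vertexMap (x' j) = x' j) → x = x')
    (Adj : (∀ j, (T j).Vertex) → (∀ j, (T j).Vertex) → Prop)
    (hAdj : ∀ (x y : ∀ j, (T j).Vertex) (g : Gtp), Adj x y →
      Adj (fun j => (ρ j g).hom.vertexMap (x j)) (fun j => (ρ j g).hom.vertexMap (y j)))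
    (hEstabN : ∀ x y : ∀ j, (T j).Vertex, (∀ ⦃i j : J⦄ (h : i ≤ j), (f h).vertexMap (x j) = x i) →
      (∀ ⦃i j : J⦄ (h : i ≤ j), (f h).vertexMap (y j) = y i) → Adj x y →
      ∃ K ∈ EN, ∀ n : N, n ∈ K ↔ (∀ j, (ρ j (ι n)).hom.vertexMap (x j) = x j) ∧
        ∀ j, (ρ j (ι n)).hom.vertexMap (y j) = y j)
    (hErigid : ∀ H ∈ VN, ∀ K ∈ EN, ∀ K' ∈ EN, K ≤ H → K' ≤ H → Subgroup.Commensurable K K' → K = K')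
    (hEinj : ∀ x y y' : ∀ j, (T j).Vertex, (∀ ⦃i j : J⦄ (h : i ≤ j), (f h).vertexMap (x j) = x i) →
      (∀ ⦃i j : J⦄ (h : i ≤ j), (f h).vertexMap (y j) = y i) →
      (∀ ⦃i j : J⦄ (h : i ≤ j), (f h).vertexMap (y' j) = y' i) → Adj x y → Adj x y' →
      (∀ n : N, ((∀ j, (ρ j (ι n)).hom.vertexMap (x j) = x j) ∧
          ∀ j, (ρ j (ι n)).hom.vertexMap (y j) = y j) ↔
        ((∀ j, (ρ j (ι n)).hom.vertexMap (x j) = x j) ∧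
          ∀ j, (ρ j (ι n)).hom.vertexMap (y' j) = y' j)) → y = y')
    {H K : Subgroup N} (hHV : H ∈ VN) {x y : ∀ j, (T j).Vertex}
    (hx : ∀ ⦃i j : J⦄ (h : i ≤ j), (f h).vertexMap (x j) = x i)
    (hy : ∀ ⦃i j : J⦄ (h : i ≤ j), (f h).vertexMap (y j) = y i) (hxy : Adj x y)
    (hH : ∀ n : N, n ∈ H ↔ ∀ j, (ρ j (ι n)).hom.vertexMap (x j) = x j)
    (hK : ∀ n : N, n ∈ K ↔ (∀ j, (ρ j (ι n)).hom.vertexMap (x j) = x j) ∧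
      ∀ j, (ρ j (ι n)).hom.vertexMap (y j) = y j) (g : Gtp) :
    g ∈ Subgroup.Commensurable.commensurator (H.map ι) ⊓ Subgroup.Commensurable.commensurator (K.map ι) ↔
      (∀ j, (ρ j g).hom.vertexMap (x j) = x j) ∧ ∀ j, (ρ j g).hom.vertexMap (y j) = y j := by
  -- the vertex half: `C(ι H)` is the stabiliser of `x`
  have hxg : g ∈ Subgroup.Commensurable.commensurator (H.map ι) ↔
      ∀ j, (ρ j g).hom.vertexMap (x j) = x j :=
    mem_commensurator_map_iff_fixes ι T ρ f hι hnorm hequiv VN hstabN hrigid huniq hHV hx hH g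
  -- the translated pair `(g·x, g·y)` and its `N`-stabiliser
  set x' : ∀ j, (T j).Vertex := fun j => (ρ j g).hom.vertexMap (x j) with hx'def
  set y' : ∀ j, (T j).Vertex := fun j => (ρ j g).hom.vertexMap (y j) with hy'def
  have hy' : ∀ ⦃i j : J⦄ (h : i ≤ j), (f h).vertexMap (y' j) = y' i :=
    compatible_translate T ρ f hequiv hy g
  -- `K ≤ H`
  have hKH : K ≤ H := fun n hn => (hH n).mpr ((hK n).mp hn).1
  rw [Subgroup.mem_inf, hxg]
  constructor
  · rintro ⟨hfx, hgK⟩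
    refine ⟨hfx, ?_⟩
    -- `g·x = x`, so the translated pair is `(x, g·y)`, again adjacent
    have hxx : x' = x := funext hfx
    have hadj' : Adj x y' := by
      have := hAdj x y g hxy
      rwa [← hx'def, hxx] at this
    obtain ⟨K', hK'E, hK'⟩ := hEstabN x y' hx hy' hadj'
    -- `g ι(K) g⁻¹ = ι(K')`
    have hK'' : ∀ n : N, n ∈ K' ↔
        (∀ j, (ρ j (ι n)).hom.vertexMap ((ρ j g).hom.vertexMap (x j)) = (ρ j g).hom.vertexMap (x j)) ∧
        ∀ j, (ρ j (ι n)).hom.vertexMap ((ρ j g).hom.vertexMap (y j)) = (ρ j g).hom.vertexMap (y j) := by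
      intro n
      rw [hK' n]
      simp only [hfx, hy'def]
    have hconj : ConjAct.toConjAct g • K.map ι = K'.map ι :=
      conj_map_pairStabilizer_eq ι T ρ hnorm g hK hK''
    -- `K` is in `EN` (it is the stabiliser of the adjacent pair `(x, y)`)
    obtain ⟨K₀, hK₀E, hK₀⟩ := hEstabN x y hx hy hxy
    have hKK₀ : K = K₀ := by
      ext n; rw [hK n, hK₀ n]
    -- commensurability pulls back along `ι`; rigidity inside `H` identifies `K' = K`
    rw [Subgroup.Commensurable.commensurator_mem_iff, hconj] at hgK
    have hcomm : Subgroup.Commensurable K' K := by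
      obtain ⟨h1, h2⟩ := hgK
      rw [Subgroup.relIndex_map_map_of_injective _ _ hι] at h1 h2
      exact ⟨h1, h2⟩
    have hK'H : K' ≤ H := fun n hn => (hH n).mpr ((hK' n).mp hn).1
    have hK'K : K' = K := by
      rw [hKK₀] at hcomm hKH ⊢
      exact hErigid H hHV K' hK'E K₀ hK₀E hK'H hKH hcomm
    -- the same stabiliser: the adjacent pairs `(x, y')`, `(x, y)` coincide
    have hyy : y = y' := hEinj x y y' hx hy hy' hxy hadj' fun n => by rw [← hK n, ← hK' n, hK'K]
    intro j
    exact (congrFun hyy j).symm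
  · rintro ⟨hfx, hfy⟩
    refine ⟨hfx, ?_⟩
    -- `g` fixes the pair, so `g ι(K) g⁻¹ = ι(K)`
    have hK'' : ∀ n : N, n ∈ K ↔
        (∀ j, (ρ j (ι n)).hom.vertexMap ((ρ j g).hom.vertexMap (x j)) = (ρ j g).hom.vertexMap (x j)) ∧
        ∀ j, (ρ j (ι n)).hom.vertexMap ((ρ j g).hom.vertexMap (y j)) = (ρ j g).hom.vertexMap (y j) := by
      intro n
      rw [hK n]
      simp only [hfx, hfy]
    have hconj : ConjAct.toConjAct g • K.map ι = K.map ι :=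
      conj_map_pairStabilizer_eq ι T ρ hnorm g hK hK''
    rw [Subgroup.Commensurable.commensurator_mem_iff, hconj]

end Generic

/-! ### The instance for the produced data: `arithBrGp` is the stabiliser of the pro-branch -/

namespace ProfiniteSemiGraph

variable {𝒢 : ProfiniteSemiGraph.{u}} {c : TemperedPiChart 𝒢} {Gtp : Type u'} [Group Gtp]
  (ι : c.G →* Gtp) {J : Type v} [Preorder J] (T : J → SemiGraph.{w}) (ρ : ∀ j, Gtp →* Aut (T j))
  (f : ∀ ⦃i j : J⦄, i ≤ j → (T j ⟶ T i))

/-- **(AI3) edge twin of row T54-0b: the arithmetic decomposition group `Π^temp_{𝔊,b}` of p. 65 — DEFINED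
as `arithBrGp R ι b = Π^temp_{𝔊,v} ⊓ C(ι Π^temp_{𝔾,b})` for `b` abutting to `v` — is the stabiliser in
`Π^temp_𝔊` of the pro-branch of `b`**, i.e. of the adjacent pair `(x, y)` of compatible tree-vertex systems
whose full `Π^temp_𝔾`-stabilisers are `R.Hv v` (for `x`) and `R.Hb b` (for the pair):
`g ∈ arithBrGp R ι b ↔ g` fixes `x` and `y`.  Inputs: the geometric dictionaries for the restricted action
— vertices (`hstabN`, `huniqN`; Thm 3.7 (ii) rigidity is discharged) and adjacent pairs (`hEstabN`,
`hErigid`, `hEinj`: total estrangement). [cite: MochizukiSemiAnbd2006, §5, p. 65] -/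
theorem mem_arithBrGp_iff_fixes_pair (h𝒢 : 𝒢.Thm37Hypotheses) (R : ChartRepresentatives c)
    (hι : Function.Injective ι) (hnorm : (ι.range).Normal)
    (hequiv : ∀ ⦃i j : J⦄ (h : i ≤ j) (g : Gtp) (z : (T j).Vertex),
      (f h).vertexMap ((ρ j g).hom.vertexMap z) = (ρ i g).hom.vertexMap ((f h).vertexMap z))
    (hstabN : ∀ x : ∀ j, (T j).Vertex, (∀ ⦃i j : J⦄ (h : i ≤ j), (f h).vertexMap (x j) = x i) →
      ∃ (v : 𝒢.graph.Vertex) (H : Subgroup c.G), H ∈ verticialSubgroups c v ∧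
        ∀ n : c.G, n ∈ H ↔ ∀ j, (ρ j (ι n)).hom.vertexMap (x j) = x j)
    (huniqN : ∀ (v : 𝒢.graph.Vertex) (H : Subgroup c.G), H ∈ verticialSubgroups c v →
      ∀ x x' : ∀ j, (T j).Vertex,
      (∀ ⦃i j : J⦄ (h : i ≤ j), (f h).vertexMap (x j) = x i) →
      (∀ ⦃i j : J⦄ (h : i ≤ j), (f h).vertexMap (x' j) = x' i) →
      (∀ n ∈ H, ∀ j, (ρ j (ι n)).hom.vertexMap (x j) = x j) →
      (∀ n ∈ H, ∀ j, (ρ j (ι n)).hom.vertexMap (x' j) = x' j) → x = x')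
    (Adj : (∀ j, (T j).Vertex) → (∀ j, (T j).Vertex) → Prop)
    (hAdj : ∀ (x y : ∀ j, (T j).Vertex) (g : Gtp), Adj x y →
      Adj (fun j => (ρ j g).hom.vertexMap (x j)) (fun j => (ρ j g).hom.vertexMap (y j)))
    (hEstabN : ∀ x y : ∀ j, (T j).Vertex, (∀ ⦃i j : J⦄ (h : i ≤ j), (f h).vertexMap (x j) = x i) →
      (∀ ⦃i j : J⦄ (h : i ≤ j), (f h).vertexMap (y j) = y i) → Adj x y →
      ∃ (e : 𝒢.graph.Edge) (K : Subgroup c.G), K ∈ edgeLikeSubgroups c e ∧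
        ∀ n : c.G, n ∈ K ↔ (∀ j, (ρ j (ι n)).hom.vertexMap (x j) = x j) ∧
          ∀ j, (ρ j (ι n)).hom.vertexMap (y j) = y j)
    (hErigid : ∀ (v : 𝒢.graph.Vertex) (H : Subgroup c.G), H ∈ verticialSubgroups c v →
      ∀ (e e' : 𝒢.graph.Edge) (K K' : Subgroup c.G), K ∈ edgeLikeSubgroups c e →
        K' ∈ edgeLikeSubgroups c e' → K ≤ H → K' ≤ H → Subgroup.Commensurable K K' → K = K')
    (hEinj : ∀ x y y' : ∀ j, (T j).Vertex, (∀ ⦃i j : J⦄ (h : i ≤ j), (f h).vertexMap (x j) = x i) →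
      (∀ ⦃i j : J⦄ (h : i ≤ j), (f h).vertexMap (y j) = y i) →
      (∀ ⦃i j : J⦄ (h : i ≤ j), (f h).vertexMap (y' j) = y' i) → Adj x y → Adj x y' →
      (∀ n : c.G, ((∀ j, (ρ j (ι n)).hom.vertexMap (x j) = x j) ∧
          ∀ j, (ρ j (ι n)).hom.vertexMap (y j) = y j) ↔
        ((∀ j, (ρ j (ι n)).hom.vertexMap (x j) = x j) ∧
          ∀ j, (ρ j (ι n)).hom.vertexMap (y' j) = y' j)) → y = y')
    {b : 𝒢.graph.Branch} {v : 𝒢.graph.Vertex} (hb : 𝒢.graph.abuts b = some v)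
    {x y : ∀ j, (T j).Vertex} (hx : ∀ ⦃i j : J⦄ (h : i ≤ j), (f h).vertexMap (x j) = x i)
    (hy : ∀ ⦃i j : J⦄ (h : i ≤ j), (f h).vertexMap (y j) = y i) (hxy : Adj x y)
    (hvx : ∀ n : c.G, n ∈ R.Hv v ↔ ∀ j, (ρ j (ι n)).hom.vertexMap (x j) = x j)
    (hbxy : ∀ n : c.G, n ∈ R.Hb b ↔ (∀ j, (ρ j (ι n)).hom.vertexMap (x j) = x j) ∧
      ∀ j, (ρ j (ι n)).hom.vertexMap (y j) = y j) (g : Gtp) :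
    g ∈ arithBrGp R ι b ↔
      (∀ j, (ρ j g).hom.vertexMap (x j) = x j) ∧ ∀ j, (ρ j g).hom.vertexMap (y j) = y j := by
  rw [arithBrGp_of_abuts R ι hb]
  exact mem_commensurator_map_inf_iff_fixes_pair ι T ρ f hι hnorm hequiv
    {H : Subgroup c.G | ∃ v, H ∈ verticialSubgroups c v} {K : Subgroup c.G | ∃ e, K ∈ edgeLikeSubgroups c e}
    (fun x hx => by
      obtain ⟨v, H, hH, h⟩ := hstabN x hx
      exact ⟨H, ⟨v, hH⟩, h⟩)
    (verticial_commensurable_rigid verticialDistinct_holds h𝒢 c)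
    (by
      rintro H ⟨v, hH⟩ x x' hx hx' h h'
      exact huniqN v H hH x x' hx hx' h h')
    Adj hAdj
    (fun x y hx hy hxy => by
      obtain ⟨e, K, hK, h⟩ := hEstabN x y hx hy hxy
      exact ⟨K, ⟨e, hK⟩, h⟩)
    (by
      rintro H ⟨v, hH⟩ K ⟨e, hK⟩ K' ⟨e', hK'⟩ hKH hK'H hc
      exact hErigid v H hH e e' K K' hK hK' hKH hK'H hc)
    hEinj ⟨v, R.Hv_mem v⟩ hx hy hxy hvx hbxy g

end ProfiniteSemiGraph

end Literature.AnabelianGeometry.SemiGraphs
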